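import Summits.HubbardSuperconductivity.HubbardLadder.ObservableWindowVector
import HarnessLib

/-!
# Rung R2 — soundness of the energy-window observable certificate ("observable-window device")

(The r2 seat's `ObservableWindow` split into three files for the 400-line limit, statements unchanged:
`ObservableWindowAbstract` = §1 window arithmetic, §2 abstract `⋆`-algebra certificate lemmas, §3a tracial
ground-state instances; `ObservableWindowVector` = §3b eigenvector / sector-ground-state / symmetrised
instances; `ObservableWindow` = §4 Hubbard rows + §5 Heisenberg rows and the full overview docstring;
import `ObservableWindow` to get everything.)

HONEST FRAMING (page 1): ladder R1–R4 with certified numbers; no claim on H/H₀. This file proves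
the SOUNDNESS EDGES of the R2 device (cell files `LADDER.md` §R2 D0–D5, `pub-hubbard-r2/INTERFACE-R2.md`
§C): a certified bracket on a ground-state OBSERVABLE `⟨V⟩` is read off an exact operator identity
```
  V - c·1 = Σᵢⱼ Λᵢⱼ Oᵢ⋆Oⱼ + (null terms) + μ·(E_up·1 - H) (+ r)
```
with `Λ ⪰ 0`, `μ ≥ 0`, null terms killed by the state (commutators `[H, X]`, symmetry defects
`U Y U⋆ - Y`, sector annihilators `Y Z + Z' Y'`), a certified energy UPPER bound `ω(H) ≤ E_up`
(R1's variational number) and, for rounded certificates, a residual `r` with `-ε ≤ Re ω(r)`: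
then `c - ε ≤ Re ω(V)`. This is the dual reading of the observable optimisation of
Wang–Surace–Frérot–Legat–Renou–Magron–Acín (PRX 2024) §3 eq. (4) — minimise `⟨ψ, O ψ⟩` over the
moment relaxation intersected with `⟨ψ, (E_up - H) ψ⟩ ≥ 0` — and of Han (2020) eq. (3); upper bounds
are the same statement for `-V`. The "scan form" (D1) needs no new certificate format at all: ANY
certified lower bound `c ≤ E₀(H + λV)` (`λ > 0`) gives `(c - E_up)/λ ≤ Re ω(V)` by the variational
principle. Instances: the tracial ground state (`Matrix.groundStateFunctional`, all null terms), unit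
eigenvectors / sector ground states (commutators + annihilators; symmetry-defect terms are NOT sound
for a single degenerate, non-symmetric sector ground state in general — but they ARE sound for every
sector ground state as soon as the OBJECTIVE is invariant under the finite unitary family generating
the defects, by evaluating the certificate in the orbit-averaged vector state:
`re_vectorState_ge_of_windowCertificate_symm`, `orbitVectorState`), the Hubbard tori's
`(N, S^z = 0)` sector ground states quantified over by `PairCorrWindowCert` (tree, `R3R4Props`;
`re_expect_sectorGS_ge_of_windowCertificate(_symm)`, constructor `PairCorrWindowCert.ofExpectBounds`),
and the two Heisenberg-side R2 rows: the staggered structure factor `m_s²(L) = neelOrderParamSq L J`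
(tree, `Targets`) and KLS's short-range staggered sum `ḡ_L(N) = heisStagShortRangeSum N L n` (tree,
`HeisenbergOrderNeelShortRange`), each written as `Re ω(explicit operator) / normalisation` so that a
certificate row instantiates them. No certificate exists in the tree; these are soundness edges, and a
finite-`L` row never bears on H₀ (no uniformity in `L`).

Prior tree art (pub-mbboot lineage, Literature): `Matrix.re_projState_ge_of_local_certificate`
(SymmetricLocalCertificate: Han's full constraint list, TRACIAL sector ground state `ω_P`) and the
Hubbard energy-constrained correlator certificates `hubbardTorus_re_projState_ge_of_local_certificate_ineq`,
`re_projState_ge_of_window_certificate_d4_ineq`, `groundState_re_expect_ge_of_window_certificate_d4_ineq`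
(HubbardCorrelatorCertificate: `certsdp/1` §6–§7 local form with multiplier `κ (u·1 − E)`; ground-state
VECTORS only at half filling via Lieb uniqueness). What this file adds: the generic finite-matrix forms
for an arbitrary Hermitian `A` (hence the Heisenberg rows), the bound for EVERY sector ground-state
vector at any filling (the `PairCorrWindowCert` quantifier at doping `1/8`, where no uniqueness theorem
is available) including the orbit-averaging argument for invariant objectives, the scan form, and the
`E_up` discharge from R1 trial states (`minEnergyOn_le_of_trialState`).
-/

namespace Summit.HubbardSuperconductivity.HubbardLadder

open Matrix Finset Filter Literature.Probability.LatticeModels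
  Literature.MathematicalPhysics.QuantumLattice
  Literature.MathematicalPhysics.QuantumManyBody.StateRelaxation
open scoped ComplexOrder

noncomputable section

/-! ## §4 The Hubbard tori: `(N, S^z = 0)` sector ground states and `PairCorrWindowCert` rows -/

section HubbardRows

variable {m : Type*} [Fintype m] [DecidableEq m]

/-- **R2 ⇒ R3 soundness edge.** On the `L × L` Hubbard torus with Hamiltonian family `H`, filling
`N` and energy window `minEnergyOn (H L) (szSector (N L) 0) ≤ E_up` (from R1's certified trial
state, `minEnergyOn_le_of_trialState`): a window certificate for an operator `V` whose annihilator
terms vanish on the whole `(N L, S^z = 0)` sector (e.g. `Z = N̂ - N`, `S^z - 0`) bounds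
`Re ⟨ψ, V ψ⟩ ≥ c` for EVERY normalised sector ground state `ψ` — the quantifier of
`PairCorrWindowCert.sound`. [cite: WangEtAl2024, §3 eq. (4)] -/
theorem re_expect_sectorGS_ge_of_windowCertificate {H : TorusHamiltonianFamily} {N : ℕ → ℕ}
    {L : ℕ} (hH : (H L).IsHermitian) {G : Matrix m m ℂ} (hG : G.PosSemidef)
    (O : m → Matrix (Finset (Orb (FermionTorus 2 L))) (Finset (Orb (FermionTorus 2 L))) ℂ)
    {κ : Type*} (s : Finset κ)
    (X : κ → Matrix (Finset (Orb (FermionTorus 2 L))) (Finset (Orb (FermionTorus 2 L))) ℂ)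
    {ι : Type*} (t : Finset ι)
    (Y Z Z' Y' : ι → Matrix (Finset (Orb (FermionTorus 2 L))) (Finset (Orb (FermionTorus 2 L))) ℂ)
    (hZ : ∀ l ∈ t, ∀ w ∈ szSector (Λ := FermionTorus 2 L) (N L) 0, Z l *ᵥ w = 0)
    (hZ' : ∀ l ∈ t, ∀ w ∈ szSector (Λ := FermionTorus 2 L) (N L) 0, (Z' l)ᴴ *ᵥ w = 0)
    {V : Matrix (Finset (Orb (FermionTorus 2 L))) (Finset (Orb (FermionTorus 2 L))) ℂ}
    {Eup μ c : ℝ} (hμ : 0 ≤ μ)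
    (hE : (H L).minEnergyOn (szSector (Λ := FermionTorus 2 L) (N L) 0) ≤ Eup)
    (hcert : V - (c : ℂ) • 1 =
      gramForm G O + (∑ k ∈ s, (H L * X k - X k * H L) + ∑ l ∈ t, (Y l * Z l + Z' l * Y' l)) +
        (μ : ℂ) • ((Eup : ℂ) • 1 - H L)) :
    ∀ ψ : Fock (Orb (FermionTorus 2 L)), star ψ ⬝ᵥ ψ = 1 →
      IsGroundStateInSector (H L) (N L) 0 ψ → c ≤ (star ψ ⬝ᵥ V *ᵥ ψ).re :=
  fun _ψ h1 hgs =>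
    re_expect_ge_of_windowCertificate_of_sectorGS hH (szSector (N L) 0) hG O s X t Y Z Z' Y' hZ hZ'
      hμ hE hcert hgs.1 h1 hgs.2.2

/-- **R2 ⇒ R3 soundness edge, symmetry-reduced certificates.** As
`re_expect_sectorGS_ge_of_windowCertificate`, but the certificate may also contain symmetry-defect
terms `U_l Y_l U_lᴴ - Y_l` for unitaries `U_l` drawn from a finite family `T : G → unitaries`
commuting with `H L`, whose adjoints preserve the `(N L, S^z = 0)` sector and which is closed under
right multiplication by each `U_l` (lattice translations, the point group) — PROVIDED the objective is
invariant, `T_g V T_gᴴ = V` (e.g. the translation-averaged `O_r = Σ_x Δ_x† Δ_{x+r}` of `P̄_d(L, r)`).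
The bound then still holds for EVERY normalised sector ground state, degenerate or not
(`re_vectorState_ge_of_windowCertificate_symm`). [cite: Han2020Bootstrap, §2 eq. (2)–(3)] -/
theorem re_expect_sectorGS_ge_of_windowCertificate_symm {H : TorusHamiltonianFamily} {N : ℕ → ℕ}
    {L : ℕ} (hH : (H L).IsHermitian)
    {G : Type*} [Fintype G] [Nonempty G]
    (T : G → Matrix (Finset (Orb (FermionTorus 2 L))) (Finset (Orb (FermionTorus 2 L))) ℂ)
    (hTA : ∀ g, T g * H L = H L * T g) (hTT : ∀ g, (T g)ᴴ * T g = 1)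
    (hTK : ∀ g, ∀ w ∈ szSector (Λ := FermionTorus 2 L) (N L) 0,
      (T g)ᴴ *ᵥ w ∈ szSector (Λ := FermionTorus 2 L) (N L) 0)
    {Gm : Matrix m m ℂ} (hG : Gm.PosSemidef)
    (O : m → Matrix (Finset (Orb (FermionTorus 2 L))) (Finset (Orb (FermionTorus 2 L))) ℂ)
    {κ : Type*} (s : Finset κ)
    (X : κ → Matrix (Finset (Orb (FermionTorus 2 L))) (Finset (Orb (FermionTorus 2 L))) ℂ)
    {ι : Type*} (t : Finset ι)
    (U Y : ι → Matrix (Finset (Orb (FermionTorus 2 L))) (Finset (Orb (FermionTorus 2 L))) ℂ)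
    (hUT : ∀ l ∈ t, ∃ σ : G ≃ G, ∀ g, T g * U l = T (σ g))
    {ρ : Type*} (r : Finset ρ)
    (Y₁ Z Z' Y₂ : ρ → Matrix (Finset (Orb (FermionTorus 2 L))) (Finset (Orb (FermionTorus 2 L))) ℂ)
    (hZ : ∀ i ∈ r, ∀ w ∈ szSector (Λ := FermionTorus 2 L) (N L) 0, Z i *ᵥ w = 0)
    (hZ' : ∀ i ∈ r, ∀ w ∈ szSector (Λ := FermionTorus 2 L) (N L) 0, (Z' i)ᴴ *ᵥ w = 0)
    {V : Matrix (Finset (Orb (FermionTorus 2 L))) (Finset (Orb (FermionTorus 2 L))) ℂ}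
    (hV : ∀ g, T g * V * (T g)ᴴ = V)
    {Eup μ c : ℝ} (hμ : 0 ≤ μ)
    (hE : (H L).minEnergyOn (szSector (Λ := FermionTorus 2 L) (N L) 0) ≤ Eup)
    (hcert : V - (c : ℂ) • 1 =
      gramForm Gm O + (∑ k ∈ s, (H L * X k - X k * H L) + ∑ l ∈ t, (U l * Y l * (U l)ᴴ - Y l) +
          ∑ i ∈ r, (Y₁ i * Z i + Z' i * Y₂ i)) +
        (μ : ℂ) • ((Eup : ℂ) • 1 - H L)) :
    ∀ ψ : Fock (Orb (FermionTorus 2 L)), star ψ ⬝ᵥ ψ = 1 →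
      IsGroundStateInSector (H L) (N L) 0 ψ → c ≤ (star ψ ⬝ᵥ V *ᵥ ψ).re :=
  fun _ψ h1 hgs =>
    re_vectorState_ge_of_windowCertificate_symm hH (szSector (N L) 0) hgs.1 h1 hgs.2.2 T hTA hTT
      hTK hG O s X t U Y hUT r Y₁ Z Z' Y₂ hZ hZ' hV hμ hE hcert

/-- **`PairCorrWindowCert` from two expectation bounds.** Given an operator `P` with
`P̄_d(L, r; ψ) = L⁻² Re ⟨ψ, P ψ⟩` (the tree's `O_r = Σ_x Δ_x† Δ_{x+r}`; hypothesis `hP`) and certified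
`c_lo ≤ Re ⟨ψ, P ψ⟩ ≤ c_hi` over the normalised `(N L, S^z = 0)` sector ground states of `H L` (two
window certificates, for `P` and for `-P`), the row `[c_lo/L², c_hi/L²]` is a `PairCorrWindowCert`.
[cite: QinEtAl2020, §II eqs. (2)–(4)] -/
def PairCorrWindowCert.ofExpectBounds {H : TorusHamiltonianFamily} {N : ℕ → ℕ} {L : ℕ}
    {r : Site 2} (P : Matrix (Finset (Orb (FermionTorus 2 L))) (Finset (Orb (FermionTorus 2 L))) ℂ)
    (hP : ∀ ψ : Fock (Orb (FermionTorus 2 L)),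
      avgPairCorr L r ψ = (star ψ ⬝ᵥ P *ᵥ ψ).re / (L : ℝ) ^ 2)
    (clo chi : ℝ)
    (hlo : ∀ ψ : Fock (Orb (FermionTorus 2 L)), star ψ ⬝ᵥ ψ = 1 →
      IsGroundStateInSector (H L) (N L) 0 ψ → clo ≤ (star ψ ⬝ᵥ P *ᵥ ψ).re)
    (hhi : ∀ ψ : Fock (Orb (FermionTorus 2 L)), star ψ ⬝ᵥ ψ = 1 →
      IsGroundStateInSector (H L) (N L) 0 ψ → (star ψ ⬝ᵥ P *ᵥ ψ).re ≤ chi) :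
    PairCorrWindowCert H N L r where
  lo := clo / (L : ℝ) ^ 2
  hi := chi / (L : ℝ) ^ 2
  sound ψ h1 hgs := by
    rw [hP]
    exact ⟨div_le_div_of_nonneg_right (hlo ψ h1 hgs) (by positivity),
      div_le_div_of_nonneg_right (hhi ψ h1 hgs) (by positivity)⟩

/-- The endpoints of `PairCorrWindowCert.ofExpectBounds`, for the record. [folklore] -/
theorem PairCorrWindowCert.ofExpectBounds_lo_hi {H : TorusHamiltonianFamily} {N : ℕ → ℕ} {L : ℕ}
    {r : Site 2} (P : Matrix (Finset (Orb (FermionTorus 2 L))) (Finset (Orb (FermionTorus 2 L))) ℂ)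
    (hP : ∀ ψ : Fock (Orb (FermionTorus 2 L)),
      avgPairCorr L r ψ = (star ψ ⬝ᵥ P *ᵥ ψ).re / (L : ℝ) ^ 2)
    (clo chi : ℝ)
    (hlo : ∀ ψ : Fock (Orb (FermionTorus 2 L)), star ψ ⬝ᵥ ψ = 1 →
      IsGroundStateInSector (H L) (N L) 0 ψ → clo ≤ (star ψ ⬝ᵥ P *ᵥ ψ).re)
    (hhi : ∀ ψ : Fock (Orb (FermionTorus 2 L)), star ψ ⬝ᵥ ψ = 1 →
      IsGroundStateInSector (H L) (N L) 0 ψ → (star ψ ⬝ᵥ P *ᵥ ψ).re ≤ chi) :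
    (PairCorrWindowCert.ofExpectBounds (H := H) (N := N) P hP clo chi hlo hhi).lo = clo / (L : ℝ) ^ 2 ∧
      (PairCorrWindowCert.ofExpectBounds (H := H) (N := N) P hP clo chi hlo hhi).hi = chi / (L : ℝ) ^ 2 :=
  ⟨rfl, rfl⟩

end HubbardRows

/-! ## §5 Heisenberg-side rows: `m_s²(L) = neelOrderParamSq` and `ḡ_L(N) = heisStagShortRangeSum` -/

section HeisenbergRows

variable {d : ℕ}
variable {m : Type*} [Fintype m] [DecidableEq m]

/-- The staggered structure-factor operator `𝓢 = Σ_{x,y} (-1)^x (-1)^y 𝐒_x · 𝐒_y` on the torus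
`(ℤ/Lℤ)²` (signs on canonical representatives, as in `neelOrderParamSq`), spin `n/2`; its
ground-state expectation divided by `L⁴` is `m_s²(L)`. [cite: WangEtAl2024, §4.3] -/
def stagStructureOp (L : ℕ) [NeZero L] (n : ℕ) : Op (TorusSite 2 L) (n + 1) :=
  ∑ x : TorusSite 2 L, ∑ y : TorusSite 2 L,
    (((-1 : ℝ) ^ (∑ i, (x i).val) * (-1) ^ (∑ i, (y i).val) : ℝ) : ℂ) •
      ∑ α : Fin 3, siteSpin n x α * siteSpin n y α

/-- Unfolding `neelOrderParamSq` at positive side. [folklore] -/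
theorem neelOrderParamSq_succ (k : ℕ) (J : ℝ) :
    neelOrderParamSq (k + 1) J =
      (∑ x : TorusSite 2 (k + 1), ∑ y : TorusSite 2 (k + 1),
          (-1 : ℝ) ^ (∑ i, (x i).val) * (-1) ^ (∑ i, (y i).val) *
            groundStateSpinCorrTorus (d := 2) (k + 1) 1 J x y) /
        ((k + 1 : ℕ) : ℝ) ^ 4 := rfl

/-- **`m_s²(L)` is an R2 functional**: `neelOrderParamSq L J = Re ω₀(𝓢) / L⁴` with `ω₀` the tracial
ground state of `heisenbergTorus 2 L 1 J` and `𝓢 = stagStructureOp L 1`. [folklore] -/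
theorem neelOrderParamSq_succ_eq_re_groundStateFunctional (k : ℕ) (J : ℝ) :
    neelOrderParamSq (k + 1) J =
      ((heisenbergTorus 2 (k + 1) 1 J).groundStateFunctional (stagStructureOp (k + 1) 1)).re /
        ((k + 1 : ℕ) : ℝ) ^ 4 := by
  rw [neelOrderParamSq_succ, stagStructureOp, map_sum, Complex.re_sum]
  congr 1
  refine Finset.sum_congr rfl fun x _ => ?_
  rw [map_sum, Complex.re_sum]
  refine Finset.sum_congr rfl fun y _ => ?_
  rw [map_smul, smul_eq_mul, Complex.re_ofReal_mul, map_sum, groundStateSpinCorrTorus_of_neZero]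

/-- **Window certificate ⇒ certified LOWER bound on `m_s²(L)` (R2 row A3–A5, Heisenberg side).**
With `A = heisenbergTorus 2 L 1 J`, `E₀(A) ≤ E_up`, and an identity
`𝓢 - c·1 = Σ Λᵢⱼ Oᵢᴴ Oⱼ + (commutators with A + symmetry defects of unitaries commuting with A) +
μ·(E_up·1 - A)`, `Λ ⪰ 0`, `μ ≥ 0`: `c / L⁴ ≤ neelOrderParamSq L J`. A theorem about ONE finite
matrix; it does not bear on H₀. [cite: WangEtAl2024, §3 eq. (4)] -/
theorem neelOrderParamSq_ge_of_windowCertificate (k : ℕ) (J : ℝ)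
    {Λ : Matrix m m ℂ} (hΛ : Λ.PosSemidef) (O : m → Op (TorusSite 2 (k + 1)) 2)
    {κ : Type*} (s : Finset κ) (X : κ → Op (TorusSite 2 (k + 1)) 2)
    {ι : Type*} (t : Finset ι) (U Y : ι → Op (TorusSite 2 (k + 1)) 2)
    (hU : ∀ l ∈ t, U l * heisenbergTorus 2 (k + 1) 1 J = heisenbergTorus 2 (k + 1) 1 J * U l)
    (hUU : ∀ l ∈ t, (U l)ᴴ * U l = 1)
    {Eup μ c : ℝ} (hμ : 0 ≤ μ) (hE : (heisenbergTorus 2 (k + 1) 1 J).groundEnergy ≤ Eup)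
    (hcert : stagStructureOp (k + 1) 1 - (c : ℂ) • 1 =
      gramForm Λ O + (∑ a ∈ s, (heisenbergTorus 2 (k + 1) 1 J * X a - X a * heisenbergTorus 2 (k + 1) 1 J) +
          ∑ l ∈ t, (U l * Y l * (U l)ᴴ - Y l)) +
        (μ : ℂ) • ((Eup : ℂ) • 1 - heisenbergTorus 2 (k + 1) 1 J)) :
    c / ((k + 1 : ℕ) : ℝ) ^ 4 ≤ neelOrderParamSq (k + 1) J := by
  rw [neelOrderParamSq_succ_eq_re_groundStateFunctional]
  exact div_le_div_of_nonneg_right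
    (re_groundStateFunctional_ge_of_windowCertificate (heisenbergTorus_isHermitian 2 (k + 1) 1 J)
      hΛ O s X t U Y hU hUU hμ hE hcert) (by positivity)

/-- **Window certificate ⇒ certified UPPER bound on `m_s²(L)`**: the same with a certificate for
`-𝓢` gives `neelOrderParamSq L J ≤ -c / L⁴`. [cite: WangEtAl2024, §3 eq. (4)] -/
theorem neelOrderParamSq_le_of_windowCertificate (k : ℕ) (J : ℝ)
    {Λ : Matrix m m ℂ} (hΛ : Λ.PosSemidef) (O : m → Op (TorusSite 2 (k + 1)) 2)
    {κ : Type*} (s : Finset κ) (X : κ → Op (TorusSite 2 (k + 1)) 2)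
    {ι : Type*} (t : Finset ι) (U Y : ι → Op (TorusSite 2 (k + 1)) 2)
    (hU : ∀ l ∈ t, U l * heisenbergTorus 2 (k + 1) 1 J = heisenbergTorus 2 (k + 1) 1 J * U l)
    (hUU : ∀ l ∈ t, (U l)ᴴ * U l = 1)
    {Eup μ c : ℝ} (hμ : 0 ≤ μ) (hE : (heisenbergTorus 2 (k + 1) 1 J).groundEnergy ≤ Eup)
    (hcert : -stagStructureOp (k + 1) 1 - (c : ℂ) • 1 =
      gramForm Λ O + (∑ a ∈ s, (heisenbergTorus 2 (k + 1) 1 J * X a - X a * heisenbergTorus 2 (k + 1) 1 J) +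
          ∑ l ∈ t, (U l * Y l * (U l)ᴴ - Y l)) +
        (μ : ℂ) • ((Eup : ℂ) • 1 - heisenbergTorus 2 (k + 1) 1 J)) :
    neelOrderParamSq (k + 1) J ≤ -c / ((k + 1 : ℕ) : ℝ) ^ 4 := by
  rw [neelOrderParamSq_succ_eq_re_groundStateFunctional]
  exact div_le_div_of_nonneg_right
    (re_groundStateFunctional_le_of_windowCertificate (heisenbergTorus_isHermitian 2 (k + 1) 1 J)
      hΛ O s X t U Y hU hUU hμ hE hcert) (by positivity)

/-- **Scan form for `m_s²(L)` (D1)**: `E₀(A) ≤ E_up` and any certified `c ≤ E₀(A + λ𝓢)`, `λ > 0`,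
give `(c - E_up)/(λ L⁴) ≤ neelOrderParamSq L J`. [folklore] -/
theorem neelOrderParamSq_ge_of_groundEnergy_add_smul (k : ℕ) (J : ℝ) {Eup lam c : ℝ}
    (hlam : 0 < lam) (hE : (heisenbergTorus 2 (k + 1) 1 J).groundEnergy ≤ Eup)
    (hS : (stagStructureOp (k + 1) 1).IsHermitian)
    (hc : c ≤ (heisenbergTorus 2 (k + 1) 1 J + (lam : ℂ) • stagStructureOp (k + 1) 1).groundEnergy) :
    (c - Eup) / lam / ((k + 1 : ℕ) : ℝ) ^ 4 ≤ neelOrderParamSq (k + 1) J := by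
  rw [neelOrderParamSq_succ_eq_re_groundStateFunctional]
  exact div_le_div_of_nonneg_right
    (re_groundStateFunctional_ge_of_groundEnergy_add_smul (heisenbergTorus_isHermitian 2 (k + 1) 1 J)
      hS hlam hE hc) (by positivity)

/-- KLS's short-range staggered-sum operator
`𝓖_N = Σ_x Σ_i Σ_{m ≤ N} (-1)^m 𝐒_x · 𝐒_{x + m eᵢ}` on `(ℤ/Lℤ)^d`, spin `n/2`; its ground-state
expectation divided by `3 d (N+1) L^d` is `ḡ_L(N) = heisStagShortRangeSum N L n`.
[cite: KLS1988JSP, eq. (10)] -/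
def stagShortRangeOp (N L n : ℕ) [NeZero L] : Op (TorusSite d L) (n + 1) :=
  ∑ x : TorusSite d L, ∑ i : Fin d, ∑ j ∈ range (N + 1),
    (((-1 : ℝ) ^ j : ℝ) : ℂ) •
      ∑ α : Fin 3, siteSpin n x α * siteSpin n (x + Pi.single i ((j : ℕ) : ZMod L)) α

/-- **`ḡ_L(N)` is an R2 functional**: `heisStagShortRangeSum N L n = Re ω₀(𝓖_N) / (3 d (N+1) L^d)`
with `ω₀` the tracial ground state of `heisenbergTorus d L n 1`. [cite: KLS1988JSP, eq. (10)] -/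
theorem heisStagShortRangeSum_eq_re_groundStateFunctional (N L n : ℕ) [NeZero L] :
    heisStagShortRangeSum (d := d) N L n =
      ((heisenbergTorus d L n 1).groundStateFunctional (stagShortRangeOp (d := d) N L n)).re /
        (3 * (d : ℝ) * ((N : ℝ) + 1) * (L : ℝ) ^ d) := by
  rw [heisStagShortRangeSum_of_neZero, stagShortRangeOp, map_sum, Complex.re_sum]
  congr 1
  refine Finset.sum_congr rfl fun x _ => ?_
  rw [map_sum, Complex.re_sum]
  refine Finset.sum_congr rfl fun i _ => ?_
  rw [map_sum, Complex.re_sum]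
  refine Finset.sum_congr rfl fun j _ => ?_
  rw [map_smul, smul_eq_mul, Complex.re_ofReal_mul, map_sum, groundStateSpinCorrTorus_of_neZero]

/-- **Window certificate ⇒ certified LOWER bound on `ḡ_L(N)` (R2 row A7; the finite-`L` shape of the
hypothesis `hcorr` of `neelOrder_spinHalf_square_of_shortRangeCorr_anderson`, which however asks it
for ALL large `L`).** With `A = heisenbergTorus d L n 1`, `E₀(A) ≤ E_up` and an identity
`𝓖_N - c·1 = Σ Λᵢⱼ Oᵢᴴ Oⱼ + (commutators + symmetry defects) + μ·(E_up·1 - A)`, `Λ ⪰ 0`, `μ ≥ 0`: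
`c / (3 d (N+1) L^d) ≤ heisStagShortRangeSum N L n`. One finite matrix; no claim on H₀.
[cite: WangEtAl2024, §3 eq. (4)] [cite: KLS1988JSP, eq. (10)] -/
theorem heisStagShortRangeSum_ge_of_windowCertificate (N L n : ℕ) [NeZero L]
    {Λ : Matrix m m ℂ} (hΛ : Λ.PosSemidef) (O : m → Op (TorusSite d L) (n + 1))
    {κ : Type*} (s : Finset κ) (X : κ → Op (TorusSite d L) (n + 1))
    {ι : Type*} (t : Finset ι) (U Y : ι → Op (TorusSite d L) (n + 1))
    (hU : ∀ l ∈ t, U l * heisenbergTorus d L n 1 = heisenbergTorus d L n 1 * U l)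
    (hUU : ∀ l ∈ t, (U l)ᴴ * U l = 1)
    {Eup μ c : ℝ} (hμ : 0 ≤ μ) (hE : (heisenbergTorus d L n 1).groundEnergy ≤ Eup)
    (hcert : stagShortRangeOp (d := d) N L n - (c : ℂ) • 1 =
      gramForm Λ O + (∑ a ∈ s, (heisenbergTorus d L n 1 * X a - X a * heisenbergTorus d L n 1) +
          ∑ l ∈ t, (U l * Y l * (U l)ᴴ - Y l)) +
        (μ : ℂ) • ((Eup : ℂ) • 1 - heisenbergTorus d L n 1)) :
    c / (3 * (d : ℝ) * ((N : ℝ) + 1) * (L : ℝ) ^ d) ≤ heisStagShortRangeSum (d := d) N L n := by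
  rw [heisStagShortRangeSum_eq_re_groundStateFunctional]
  exact div_le_div_of_nonneg_right
    (re_groundStateFunctional_ge_of_windowCertificate (heisenbergTorus_isHermitian d L n 1)
      hΛ O s X t U Y hU hUU hμ hE hcert) (by positivity)

end HeisenbergRows

end

end Summit.HubbardSuperconductivity.HubbardLadder
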